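import Literature.Geometry.Lorentzian.BoundedScaleFreeGeometry
import Literature.Geometry.Lorentzian.MinkowskiCauchyDevelopment
import HarnessLib

/-!
# Bounded scale-free geometry: the curvature size is attained, and the Minkowski instance

Proof file (everything proved, no definitions, no named facts) accompanying
`BoundedScaleFreeGeometry.lean` (`CauchyDevelopment.HasBoundedScaleFreeGeometry`, definition request
`defn-HasBoundedScaleFreeGeometry` of route ConcentrationCannotWait).

* **Finite-dimensional tangent spaces.** For a unit timelike observer `T` at `x` the observer form
  `h_T` is coercive (`exists_pos_mul_norm_sq_le_observerInner`: `c ‖v‖² ≤ h_T(v, v)`, minimum on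
  the compact unit sphere of the model space), hence a curvature bound in the frame of `T` always
  exists (`exists_isCurvatureBoundedAt`: `R_x`, `g_x` are bounded multilinear maps), the infimum
  defining the curvature size `|Riem|_T(x)` is attained (`isCurvatureBoundedAt_curvatureSize`), and
  `IsCurvatureBoundedAt g x T C ↔ curvatureSize g x T ≤ C` for `C ≥ 0`
  (`isCurvatureBoundedAt_iff_curvatureSize_le`). Consequently
  `CauchyDevelopment.hasBoundedScaleFreeGeometry_iff`: bounded scale-free geometry is exactly a
  uniform bound of `|Riem|_T` on `J⁺(ι X)` for some lapse-bounded observer field.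
* **Non-vacuity.** The vacuum Cauchy development `(ℝ⁴, η, ∂ₜ)` of the trivial data `(ℝ³, δ, 0)`
  (`Minkowski.vacuumCauchyDevelopment`) has bounded scale-free geometry: `t = x⁰`, `T = ∂₀` is a
  lapse-bounded observer field on all of `ℝ⁴` (lapse `≡ 1`) and `Riem(η) = 0`
  (`Minkowski.riemann_smoothMetric_eq_zero`), so `C = 0` works
  (`Minkowski.hasBoundedScaleFreeGeometry_vacuumCauchyDevelopment`); hence Minkowski spacetime does
  not blow up at infinity, and its curvature scale relative to the inertial observers is `⊤`.

## References

* D. Christodoulou, S. Klainerman, *The Global Nonlinear Stability of the Minkowski Space*, PUP 1993,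
  Introduction, (1.0.1); §7.2, p. 143.
* B. O'Neill, *Semi-Riemannian geometry*, Academic Press 1983, Ch. 3, remark after Prop. 3.41
  (Minkowski space is flat); Ch. 5, Lemma 5.26.
-/

noncomputable section

open Manifold Set Topology
open scoped ContDiff

universe u

namespace Literature.Geometry.Lorentzian

variable {E : Type*} [NormedAddCommGroup E] [NormedSpace ℝ E] {H : Type*} [TopologicalSpace H]
  {I : ModelWithCorners ℝ E H} {n : ℕ∞ω} {M : Type*} [TopologicalSpace M] [ChartedSpace H M]
  [IsManifold I ∞ M]

/-! ### Finite-dimensional tangent spaces: the curvature size is an admissible bound -/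

-- instance search on the nested operator spaces `E →L[ℝ] E →L[ℝ] E →L[ℝ] E` is deep
-- (as in `ADMFrameIndependence.lean`)
set_option maxSynthPendingDepth 3

section Coercive

omit [NormedSpace ℝ E] in
/-- **A positive definite quadratic function is coercive** (finite dimension): a continuous
`f : E → ℝ` on a finite-dimensional real normed space with `f (a • v) = a² f v` and `f v > 0` for
`v ≠ 0` satisfies `c ‖v‖² ≤ f v` for some `c > 0` (minimum of `f` on the compact unit sphere).
[folklore] -/
theorem exists_pos_mul_norm_sq_le_of_two_homogeneous [NormedSpace ℝ E] [FiniteDimensional ℝ E]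
    {f : E → ℝ} (hf : Continuous f) (hhom : ∀ (a : ℝ) (v : E), f (a • v) = a ^ 2 * f v)
    (hpos : ∀ v : E, v ≠ 0 → 0 < f v) : ∃ c : ℝ, 0 < c ∧ ∀ v : E, c * ‖v‖ ^ 2 ≤ f v := by
  have hf0 : f 0 = 0 := by simpa using hhom 0 0
  rcases subsingleton_or_nontrivial E with hE | hE
  · exact ⟨1, one_pos, fun v ↦ by simp [Subsingleton.elim v 0, hf0]⟩
  obtain ⟨v₀, hv₀, hmin⟩ := (isCompact_sphere (0 : E) 1).exists_isMinOn
    (NormedSpace.sphere_nonempty.2 zero_le_one) hf.continuousOn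
  have hv₀' : ‖v₀‖ = 1 := by simpa using hv₀
  have hv₀0 : v₀ ≠ 0 := by
    rintro rfl
    simp at hv₀'
  refine ⟨f v₀, hpos v₀ hv₀0, fun v ↦ ?_⟩
  by_cases hv : v = 0
  · subst hv
    simp [hf0]
  have hnv : 0 < ‖v‖ := norm_pos_iff.mpr hv
  have hnv' : ‖v‖ ≠ 0 := hnv.ne'
  have hu : ‖v‖⁻¹ • v ∈ Metric.sphere (0 : E) 1 := by
    simp [norm_smul, inv_mul_cancel₀ hnv']
  have h2 : f v₀ ≤ ‖v‖⁻¹ ^ 2 * f v := (isMinOn_iff.mp hmin _ hu).trans_eq (hhom _ _)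
  calc f v₀ * ‖v‖ ^ 2 ≤ ‖v‖⁻¹ ^ 2 * f v * ‖v‖ ^ 2 := by gcongr
    _ = f v := by field_simp

/-- Operator-norm bound for a bilinear form evaluated on a trilinear map:
`|B(R(X,Y,Z), W)| ≤ ‖B‖ ‖R‖ ‖X‖ ‖Y‖ ‖Z‖ ‖W‖`. [folklore] -/
theorem abs_bilin_apply_trilin_le (B : E →L[ℝ] E →L[ℝ] ℝ) (R : E →L[ℝ] E →L[ℝ] E →L[ℝ] E)
    (X Y Z W : E) : |B (R X Y Z) W| ≤ ‖B‖ * ‖R‖ * ‖X‖ * ‖Y‖ * ‖Z‖ * ‖W‖ := by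
  have hR : ‖R X Y Z‖ ≤ ‖R‖ * ‖X‖ * ‖Y‖ * ‖Z‖ :=
    calc ‖R X Y Z‖ ≤ ‖R X Y‖ * ‖Z‖ := (R X Y).le_opNorm Z
      _ ≤ ‖R X‖ * ‖Y‖ * ‖Z‖ := by gcongr; exact (R X).le_opNorm Y
      _ ≤ ‖R‖ * ‖X‖ * ‖Y‖ * ‖Z‖ := by gcongr; exact R.le_opNorm X
  calc |B (R X Y Z) W| = ‖B (R X Y Z) W‖ := (Real.norm_eq_abs _).symm
    _ ≤ ‖B‖ * ‖R X Y Z‖ * ‖W‖ := B.le_opNorm₂ (R X Y Z) W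
    _ ≤ ‖B‖ * (‖R‖ * ‖X‖ * ‖Y‖ * ‖Z‖) * ‖W‖ := by gcongr
    _ = ‖B‖ * ‖R‖ * ‖X‖ * ‖Y‖ * ‖Z‖ * ‖W‖ := by ring

end Coercive

namespace LorentzianMetric

variable {g : LorentzianMetric I n M} {x : M}

/-- Homogeneity of the observer form: `h_T(a v, a v) = a² h_T(v, v)`. [folklore] -/
lemma observerInner_smul_smul (T v : TangentSpace I x) (a : ℝ) :
    g.observerInner x T (a • v) (a • v) = a ^ 2 * g.observerInner x T v v := by
  simp only [observerInner_apply, map_smul, FunLike.coe_smul, Pi.smul_apply, smul_eq_mul]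
  ring

/-- The observer form `v ↦ h_T(v, v)` is continuous on the tangent space (a polynomial in the
continuous bilinear form `g_x`). [folklore] -/
lemma continuous_observerInner_self (T : TangentSpace I x) :
    Continuous fun v : E ↦ g.observerInner x T v v := by
  have h1 : Continuous fun v : E ↦ (show E →L[ℝ] E →L[ℝ] ℝ from g.val x) v v :=
    (show E →L[ℝ] E →L[ℝ] ℝ from g.val x).continuous₂.comp (continuous_id.prodMk continuous_id)
  have h2 : Continuous fun v : E ↦ (show E →L[ℝ] E →L[ℝ] ℝ from g.val x) T v :=
    ((show E →L[ℝ] E →L[ℝ] ℝ from g.val x) T).continuous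
  exact h1.fun_add ((continuous_const.fun_mul h2).fun_mul h2)

variable [FiniteDimensional ℝ E]

/-- **Coercivity of the observer form.** On a finite-dimensional tangent space, for a unit timelike
observer `T` there is `c > 0` with `c ‖v‖² ≤ h_T(v, v)` for all `v` (norm of the model space `E`).
O'Neill 1983, Ch. 5, Lemma 5.26 (positivity); compactness of the unit sphere. [folklore] -/
theorem exists_pos_mul_norm_sq_le_observerInner {T : TangentSpace I x} (hT : g.val x T T = -1) :
    ∃ c : ℝ, 0 < c ∧ ∀ v : E, c * ‖v‖ ^ 2 ≤ g.observerInner x T v v :=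
  exists_pos_mul_norm_sq_le_of_two_homogeneous (continuous_observerInner_self T)
    (fun a v ↦ observerInner_smul_smul T v a) (fun _ hv ↦ observerInner_self_pos hT hv)

/-- The model norm is dominated by the observer norm: `‖v‖ ≤ ‖v‖_T / √c`. [folklore] -/
theorem exists_norm_le_mul_observerNorm {T : TangentSpace I x} (hT : g.val x T T = -1) :
    ∃ a : ℝ, 0 < a ∧ ∀ v : E, ‖v‖ ≤ a * g.observerNorm x T v := by
  obtain ⟨c, hc, hcv⟩ := exists_pos_mul_norm_sq_le_observerInner hT
  refine ⟨(√c)⁻¹, inv_pos.mpr (Real.sqrt_pos.mpr hc), fun v ↦ ?_⟩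
  rw [le_inv_mul_iff₀ (Real.sqrt_pos.mpr hc)]
  calc √c * ‖v‖ = √(c * ‖v‖ ^ 2) := by rw [Real.sqrt_mul hc.le, Real.sqrt_sq (norm_nonneg v)]
    _ ≤ g.observerNorm x T v := Real.sqrt_le_sqrt (hcv v)

variable [g.HasLeviCivita]

/-- **A curvature bound exists** at every point of a finite-dimensional tangent space for a unit
timelike observer: `R_x` and `g_x` are bounded multilinear maps and `‖·‖_T` dominates the model
norm. [folklore] -/
theorem exists_isCurvatureBoundedAt {T : TangentSpace I x} (hT : g.val x T T = -1) :
    ∃ C : ℝ, 0 ≤ C ∧ g.IsCurvatureBoundedAt x T C := by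
  obtain ⟨a, ha, hav⟩ := exists_norm_le_mul_observerNorm hT
  have key := fun X Y Z W : E ↦ abs_bilin_apply_trilin_le (show E →L[ℝ] E →L[ℝ] ℝ from g.val x)
    (show E →L[ℝ] E →L[ℝ] E →L[ℝ] E from g.riemann x) X Y Z W
  refine ⟨‖show E →L[ℝ] E →L[ℝ] ℝ from g.val x‖ * ‖show E →L[ℝ] E →L[ℝ] E →L[ℝ] E from g.riemann x‖ *
    a ^ 4, by positivity, fun X Y Z W ↦ ?_⟩
  have hn := fun v : E ↦ observerNorm_nonneg (g := g) (x := x) T v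
  have hX := hn X; have hY := hn Y; have hZ := hn Z; have hW := hn W
  calc |g.val x (g.riemann x X Y Z) W|
      ≤ ‖show E →L[ℝ] E →L[ℝ] ℝ from g.val x‖ * ‖show E →L[ℝ] E →L[ℝ] E →L[ℝ] E from g.riemann x‖ *
          ‖show E from X‖ * ‖show E from Y‖ * ‖show E from Z‖ * ‖show E from W‖ := key X Y Z W
    _ ≤ ‖show E →L[ℝ] E →L[ℝ] ℝ from g.val x‖ * ‖show E →L[ℝ] E →L[ℝ] E →L[ℝ] E from g.riemann x‖ *
          (a * g.observerNorm x T X) * (a * g.observerNorm x T Y) * (a * g.observerNorm x T Z) *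
          (a * g.observerNorm x T W) := by
        gcongr <;> exact hav _
    _ = ‖show E →L[ℝ] E →L[ℝ] ℝ from g.val x‖ * ‖show E →L[ℝ] E →L[ℝ] E →L[ℝ] E from g.riemann x‖ *
          a ^ 4 * (g.observerNorm x T X * g.observerNorm x T Y * g.observerNorm x T Z *
          g.observerNorm x T W) := by ring

omit [FiniteDimensional ℝ E] in
/-- The set of admissible curvature bounds at `x` in the frame of `T` is closed. [folklore] -/
lemma isClosed_setOf_isCurvatureBoundedAt (T : TangentSpace I x) :
    IsClosed {C : ℝ | 0 ≤ C ∧ g.IsCurvatureBoundedAt x T C} := by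
  have : {C : ℝ | 0 ≤ C ∧ g.IsCurvatureBoundedAt x T C} =
      Ici 0 ∩ ⋂ X : TangentSpace I x, ⋂ Y : TangentSpace I x, ⋂ Z : TangentSpace I x,
        ⋂ W : TangentSpace I x, {C : ℝ | |g.val x (g.riemann x X Y Z) W| ≤
          C * (g.observerNorm x T X * g.observerNorm x T Y * g.observerNorm x T Z *
            g.observerNorm x T W)} := by
    ext C
    simp [IsCurvatureBoundedAt]
  rw [this]
  exact isClosed_Ici.inter <| isClosed_iInter fun _ ↦ isClosed_iInter fun _ ↦
    isClosed_iInter fun _ ↦ isClosed_iInter fun _ ↦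
      isClosed_le continuous_const (continuous_id.mul continuous_const)

/-- **The curvature size is itself an admissible bound** (the infimum is attained): for a unit
timelike observer on a finite-dimensional tangent space,
`|g(R(X,Y)Z, W)| ≤ |Riem|_T(x) ‖X‖_T ‖Y‖_T ‖Z‖_T ‖W‖_T`. [folklore] -/
theorem isCurvatureBoundedAt_curvatureSize {T : TangentSpace I x} (hT : g.val x T T = -1) :
    g.IsCurvatureBoundedAt x T (g.curvatureSize x T) := by
  obtain ⟨C, hC, hb⟩ := exists_isCurvatureBoundedAt hT
  exact ((isClosed_setOf_isCurvatureBoundedAt T).csInf_mem ⟨C, hC, hb⟩ ⟨0, fun _ h ↦ h.1⟩).2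

/-- For a unit timelike observer on a finite-dimensional tangent space, the curvature is bounded by
`C ≥ 0` in the frame of `T` iff `|Riem|_T(x) ≤ C`. [folklore] -/
theorem isCurvatureBoundedAt_iff_curvatureSize_le {T : TangentSpace I x} (hT : g.val x T T = -1)
    {C : ℝ} (hC : 0 ≤ C) : g.IsCurvatureBoundedAt x T C ↔ g.curvatureSize x T ≤ C :=
  ⟨fun h ↦ h.curvatureSize_le hC, fun h ↦ (isCurvatureBoundedAt_curvatureSize hT).mono h⟩

end LorentzianMetric

namespace CauchyDevelopment

variable {d : ℕ} {X : Type u} [TopologicalSpace X] [ChartedSpace (EuclideanSpace ℝ (Fin d)) X]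
  [IsManifold (𝓡 d) ∞ X] [ConnectedSpace X] {D : InitialDataSet (𝓡 d) X} {𝒟 : CauchyDevelopment D}

/-- **Bounded scale-free geometry ⇔ uniformly bounded curvature size**: `𝒟` has bounded
scale-free geometry iff for some lapse-bounded observer field on `J⁺(ι X)` the curvature size
`|Riem|_T` is uniformly bounded there. [folklore] -/
theorem hasBoundedScaleFreeGeometry_iff :
    𝒟.HasBoundedScaleFreeGeometry ↔ ∀ [𝒟.metric.HasLeviCivita],
      ∃ (t : 𝒟.carrier → ℝ) (T : Π p : 𝒟.carrier, TangentSpace (𝓡 (d + 1)) p) (N₀ N₁ C : ℝ),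
        𝒟.metric.IsLapseBoundedObserverOn 𝒟.timeOrientation 𝒟.dataCausalFuture t T N₀ N₁ ∧
          ∀ p ∈ 𝒟.dataCausalFuture, 𝒟.curvatureSize T p ≤ C := by
  refine ⟨fun h _ ↦ h.exists_curvatureSize_le, fun h _ ↦ ?_⟩
  obtain ⟨t, T, N₀, N₁, C, hobs, hC⟩ := h
  exact ⟨t, T, N₀, N₁, C, hobs, fun p hp ↦
    (LorentzianMetric.isCurvatureBoundedAt_curvatureSize (hobs.val_self p hp)).mono (hC p hp)⟩

end CauchyDevelopment

/-! ### Non-vacuity: Minkowski spacetime -/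

namespace Minkowski

/-- **Minkowski spacetime has bounded scale-free geometry**: for the vacuum Cauchy development
`(ℝ⁴, η, ∂ₜ)` of the trivial data `(ℝ³, δ, 0)` (`Minkowski.vacuumCauchyDevelopment`), the time
coordinate `t = x⁰` with the inertial observer field `T = ∂₀` is a lapse-bounded observer field
(lapse `≡ 1`) on all of `ℝ⁴`, and the Riemann tensor vanishes (`riemann_smoothMetric_eq_zero`), so
the curvature is bounded by `C = 0`. Christodoulou–Klainerman 1993, Introduction, (1.0.1) with
`φ ≡ 1`; O'Neill 1983, Ch. 3, remark after Prop. 3.41 (Minkowski space is flat).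
[cite: ChristodoulouKlainerman1993PMS41, Introduction, (1.0.1)] -/
theorem hasBoundedScaleFreeGeometry_vacuumCauchyDevelopment :
    vacuumCauchyDevelopment.toCauchyDevelopment.HasBoundedScaleFreeGeometry := by
  intro hLC
  have hLC' : smoothMetric.toPseudoRiemannianMetric.HasLeviCivita := hLC
  -- restate over `E4` (everything is definitionally the Minkowski data)
  change ∃ (t : E4 → ℝ) (T : Π p : E4, TangentSpace 𝓘(ℝ, E4) p) (N₀ N₁ C : ℝ),
      smoothMetric.IsLapseBoundedObserverOn (timeOrientation.ofLE le_top)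
          (smoothMetric.causalFuture (timeOrientation.ofLE le_top) (range sliceEmbed)) t T N₀ N₁ ∧
        ∀ p ∈ smoothMetric.causalFuture (timeOrientation.ofLE le_top) (range sliceEmbed),
          smoothMetric.IsCurvatureBoundedAt p (T p) C
  refine ⟨E4.time, fun _ ↦ E4.basisVector 0, 1, 1, 0, ?_, fun p _ ↦ ?_⟩
  · -- `d(x⁰)_p = dx⁰` at every point
    have hdt : ∀ (p : E4) (v : TangentSpace 𝓘(ℝ, E4) p),
        mvfderiv 𝓘(ℝ, E4) E4.time p v = E4.dx 0 v := fun p v ↦ by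
      rw [ModelSpace.mvfderiv_eq_fderiv]
      change fderiv ℝ (⇑(E4.dx 0)) p v = _
      rw [ContinuousLinearMap.fderiv]
    refine
      { lapse_pos := one_pos
        lapse_le := le_rfl
        contMDiff := contMDiff_iff_contDiff.mpr (E4.dx 0).contDiff
        val_self := fun p _ ↦ bilin_basisVector_zero
        isFutureDirected := fun p _ ↦ (timeOrientation.ofLE le_top).isFutureDirected_vectorField p
        normal := fun p _ v hv ↦ ?_
        lapse_mem := fun p _ ↦ ?_ }
    · rw [hdt] at hv
      exact (bilin_basisVector_zero_left v).trans (neg_eq_zero.mpr hv)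
    · rw [hdt, inv_one]
      simp
  · exact LorentzianMetric.isCurvatureBoundedAt_zero_of_riemann_eq_zero
      (riemann_smoothMetric_eq_zero p) _

/-- Hence Minkowski spacetime does not blow up at infinity. [folklore] -/
theorem not_blowsUpAtInfinity_vacuumCauchyDevelopment :
    ¬ vacuumCauchyDevelopment.toCauchyDevelopment.BlowsUpAtInfinity :=
  hasBoundedScaleFreeGeometry_vacuumCauchyDevelopment.not_blowsUpAtInfinity

end Minkowski

end Literature.Geometry.Lorentzian

end
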